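import Summits.BirchSwinnertonDyer.BirchSwinnertonDyer.Theorems.PrintCf2SplitBadTwoLowerHalfOfFactsEisensteinFrameBridge
import Summits.BirchSwinnertonDyer.Rank1Residual.Partition.CornersCM
import Literature.NumberTheory.EllipticCurves.BSDSelmerCMPConverseGoldfeldProofs
import Literature.NumberTheory.EllipticCurves.HeegnerPointsKolyvaginExceptionalTwistProofs
import Literature.NumberTheory.EllipticCurves.Milne1972.WeilRestrictionQuadraticBSDQuotientOfAnyModelProofs
import Literature.NumberTheory.EllipticCurves.BSDRootNumberSmallConductorAssemblyProofs
import Literature.NumberTheory.EllipticCurves.BSDRootNumber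
import Literature.NumberTheory.EllipticCurves.KrizLi2019.TwoPartBSDTwists
import HarnessLib

/-!
# Children 27850 / 27851 of crux `PrintCf2.SplitBadTwoRankOneOfFacts`, line `heegner_index_two` (v3) — the SMALL-CONDUCTOR slice:
# `BSD₂(W)` over `ℚ` (e.g. Creutz–Miller, `N_W < 5000`) ⟹ the Heegner-index EQUALITY on every Heegner frame, hence both v3 stub texts there

Cell `bsd-print-cf2`, seat `bsd-line-cf2-p1-w4` g3 (EXTRA WIDTH seat on crux stmt-BirchSwinnertonDyer-20368). `--supports stmt-BirchSwinnertonDyer-27850`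
(helper; serves 27851 equally). Planner g16 RULING (y) (5): «U_{<5000} (N_W ∈ {784, 3136}: Miller by name + the index bridges, S-size) lands as a
`--supports` lemma by any idle seat, no item». Theses-free; THEOREMS ONLY (0 definitions, 0 named facts, 0 `sorry`); CONDITIONAL on every displayed
hypothesis (named facts taken as hypotheses: the toric prints, Milne 1972, Burungale–Flach rank 0, Creutz–Miller 2012 = bsd.S31). BSD is proved for no
curve by any of this; no summit statement is proved by this seat.

WHY. Road (β) (finite-level Kolyvagin at `2`) is barred on the infinite bulk of the class by `StringentKolyvaginCapsAtMax` (memo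
`Cruxes/SplitBadTwoRankOneOfFacts/ROAD-BETA-VERDICT-w4g3.md`); its complement inside the barrier's reach — the members with `t = v₂∏c_ℓ = 3` — have
`N_W ∈ {784, 3136} < 5000`, where `BSD₂(W)` is the computer-assisted theorem of Creutz–Miller 2012 (tree named fact
`bsdTriple_of_rank_le_one_of_conductor_lt`, bsd.S31). This file turns `BSD₂(W)` over `ℚ` into the v3 research stubs' conclusions on every Heegner frame
of `W` (the direction `ℚ → K`, converse to the bridges p638495 / p638806 / p638826): Milne's identity (★) + the twin's `BSD₂` + Gross–Zagier's exact
value give the frame EQUALITY `ord₂ #Ш(E/K)[2^∞] + ord₂ c_K = 2·ord₂ [E(K):ℤP] − 2·ord₂ c`.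

* §1 `heegnerIndexEq_two_of_bsdp_of_twist` — ONE `W` with `r_an(W) = 1` and `BSD₂(W)`: toric prints + Milne + twin `BSD₂` ⟹ the equality on every
  Heegner frame with `d_K < −4`, `P` non-torsion.
* §2 `heegnerIndexEq_two_of_conductor_lt` — class-free corollary from bsd.S31 (`N_W < 5000`) + Burungale–Flach twin (needs `W.HasCM`);
  `heegnerIndexUpperAtTwo_of_conductor_lt` / `heegnerIndexLowerAtTwo_of_conductor_lt` — the two v3 stub texts (`stub_heegnerIndexUpperAtTwo` of
  27850, `stub_heegnerIndexLowerAtTwo` of 27851; displayed binders verbatim) RESTRICTED to `N_W < 5000`. Not the stubs (which are class-wide).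

References: [CreutzMiller2012] Thm 1.1; [Miller2011LMS] Def. 1.1, Thm 1.2; [Milne1972ArithmeticAV] §1 Thm. 1; [GrossZagier1986] V.(2.2);
[BurungaleFlach2024] Thm. 1.1 (rank 0, all p).
-/

set_option autoImplicit false

-- D-0017 layout: summit = sub-problem, so `Summit.BirchSwinnertonDyer.BirchSwinnertonDyer.…` is the mandated namespace of Theorems files.
set_option linter.dupNamespace false

noncomputable section

open scoped Classical NumberField

namespace Summit.BirchSwinnertonDyer.BirchSwinnertonDyer.Theorems.PrintCf2.KsideFiniteTwo

open WeierstrassCurve NumberField IsDedekindDomain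
  Literature.NumberTheory.EllipticCurves Literature.NumberTheory.EllipticCurves.ModularForms
  Literature.NumberTheory.EllipticCurves.Rank1Residual Literature.NumberTheory.EllipticCurves.Rank1Residual.Typed
  Literature.NumberTheory.EllipticCurves.KrizLi2019
  Summit.BirchSwinnertonDyer.Rank1Residual Summit.BirchSwinnertonDyer.Rank1Residual.AdditivePotMult
  Summit.BirchSwinnertonDyer.BirchSwinnertonDyer.Theses.UniversalToricDescent
  Summit.BirchSwinnertonDyer.BirchSwinnertonDyer.Theorems.PrintCf2.EisensteinTwo

/-! ### §1 `BSD₂(W)` over `ℚ` ⟹ the Heegner-index EQUALITY on every frame -/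

/-- **`BSD₂(W)` ⟹ `ord₂ #Ш(E/K)[2^∞] + ord₂ c_K = 2·ord₂ [E(K):ℤP] − 2·ord₂ c` on every Heegner frame.** ONE globally minimal `W/ℚ` with
`r_an(W) = 1` and `BSDp W 2`; GIVEN the toric prints `hF` (GZ, Kolyvagin, GZK, modularity used), Milne 1972 on minimal models `hMilne`, and the
twin's `BSD₂` `hTw` at every Heegner field with `L(E^{(d_K)},1) ≠ 0`: THEN on every Heegner frame `(N, K, Dt, H, ι, P)` of `W` with `d_K < −4` and
`P` non-torsion the index EQUALITY holds. Route: `P` non-torsion ⟹ `L(E^{(d_K)},1) ≠ 0`, `r_an(E_K) = 1`; Gross–Zagier's exact value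
(`exists_shaAnOver_baseChange_eq_padicValRat_two`: `ord₂ #Ш_an(E_K) = 2ord₂I − 2ord₂c − ord₂c_K`); Milne (★) + twin `BSD₂`
(`exists_shaAn_valuation_sub_eq_of_bsdp_twist`: the `2`-adic BSD defects of `W/ℚ` and `E_K/K` agree); `BSDp W 2` kills the defect.
[cite: Milne1972ArithmeticAV, §1 Thm. 1] [cite: GrossZagier1986, Thm. I.6.3 and V.(2.2)] [cite: Miller2011LMS, Def. 1.1] -/
theorem heegnerIndexEq_two_of_bsdp_of_twist (hF : ToricPublishedInputs) (hMilne : Milne1972.bsdQuotient_baseChange_quadratic)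
    (W : WeierstrassCurve ℚ) [W.IsElliptic] [W.IsGloballyMinimal] (hr : W.analyticRank = 1) (hW2 : BSDp W 2)
    (hTw : ∀ (N : ℕ) [NeZero N] (K : Type) [Field K] [NumberField K]
      (Wd : WeierstrassCurve ℚ) [Wd.IsElliptic] [Wd.IsGloballyMinimal],
      W.conductorNorm ℤ = N → IsImaginaryQuadratic K → SatisfiesHeegnerHypothesis N K →
      (∃ C : VariableChange ℚ, C • W.quadraticTwist (NumberField.discr K : ℚ) = Wd) →
      (W.quadraticTwist (NumberField.discr K : ℚ)).entireLFunction 1 ≠ 0 → BSDp Wd 2) :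
    ∀ (N : ℕ) [NeZero N] (K : Type) [Field K] [NumberField K] (Dt : ModularParametrizationData W N)
      (H : HeegnerDatum N (NumberField.discr K)) (ι : K →+* ℂ) (P : (W.baseChange K).toAffine.Point),
      W.conductorNorm ℤ = N → IsImaginaryQuadratic K → SatisfiesHeegnerHypothesis N K → NumberField.discr K < -4 →
      WeierstrassCurve.Affine.Point.map ι.toRatAlgHom P = heegnerPointComplex Dt H → ¬ IsOfFinAddOrder P →
      (padicValNat 2 (Nat.card (AddCommGroup.primaryComponent (W.baseChange K).sha 2)) : ℤ) +
          (padicValNat 2 (W.baseChange K).tamagawaProduct : ℤ) =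
        2 * (padicValNat 2 (AddSubgroup.zmultiples P).index : ℤ) - 2 * (padicValNat 2 Dt.c.natAbs : ℤ) := by
  intro N _ K _ _ Dt H ι P hN hK hHN hd4 hP hnt
  obtain ⟨hGZ, hKo, hGZK, hmod, -, -, -, -, -, -⟩ := hF
  subst hN
  have h2 : Module.finrank ℚ K = 2 := hK.1
  ------------------------------------------------------------------ `L(E^{(d_K)},1) ≠ 0` from `P` non-torsion, `r_an(E_K) = 1`
  have hL0 : W.entireLFunction 1 = 0 := entireLFunction_one_eq_zero_of_analyticRank_eq_one hr
  have hLK : LDerivEK W K ≠ 0 :=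
    (lDerivEK_ne_zero_iff_not_isOfFinAddOrder W (W.conductorNorm ℤ) K (hGZ _ W K) hK hHN ⟨Dt, H, ι, hP⟩).mpr hnt
  have hLt : (W.quadraticTwist (NumberField.discr K : ℚ)).entireLFunction 1 ≠ 0 := by
    intro h0
    apply hLK
    rw [lDerivEK_eq_deriv_mul W K hmod hL0, h0, mul_zero]
  have hD0 : (NumberField.discr K : ℚ) ≠ 0 := by exact_mod_cast NumberField.discr_ne_zero K
  haveI hEt : (W.quadraticTwist (NumberField.discr K : ℚ)).IsElliptic := W.isElliptic_quadraticTwist hD0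
  have hrd0 : (W.quadraticTwist (NumberField.discr K : ℚ)).analyticRank = 0 :=
    ((W.quadraticTwist (NumberField.discr K : ℚ)).analyticRank_eq_zero_iff_holds (hmod _)).mpr hLt
  have hrK : (W.baseChange K).analyticRank = 1 :=
    (Summit.BirchSwinnertonDyer.Rank1Residual.P2.analyticRank_baseChange_eq_one_iff W K hmod h2).mpr (Or.inl ⟨hr, hrd0⟩)
  ------------------------------------------------------------------ Gross–Zagier exact value and its valuation
  obtain ⟨hShaK, q', hq', hv⟩ :=
    exists_shaAnOver_baseChange_eq_padicValRat_two W K Dt H ι P (hGZ _ W K) (hKo _ W K) hmod hK hd4 hHN hP hrK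
  haveI : Finite (W.baseChange K).sha := hShaK
  ------------------------------------------------------------------ twin, Milne (★), `BSD₂(W)`
  haveI : (W.baseChange K).IsGloballyMinimal := W.isGloballyMinimal_baseChange_of_satisfiesHeegnerHypothesis K h2 hHN
  haveI : (W.baseChange K).IsElliptic := isElliptic_baseChange' W K
  obtain ⟨Cd, hCd⟩ := hasGlobalMinimalModel_rat_holds (W.quadraticTwist (NumberField.discr K : ℚ))
  haveI : (Cd • W.quadraticTwist (NumberField.discr K : ℚ)).IsGloballyMinimal := hCd
  have hWd : BSDp (Cd • W.quadraticTwist (NumberField.discr K : ℚ)) 2 :=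
    hTw (W.conductorNorm ℤ) K (Cd • W.quadraticTwist (NumberField.discr K : ℚ)) rfl hK hHN ⟨Cd, rfl⟩ hLt
  have hrW : W.analyticRank ≤ 1 := by rw [hr]
  have hrd : (Cd • W.quadraticTwist (NumberField.discr K : ℚ)).analyticRank ≤ 1 := by
    rw [analyticRank_smul, hrd0]; exact zero_le_one
  obtain ⟨q, hq, hdef⟩ := exists_shaAn_valuation_sub_eq_of_bsdp_twist W 2 K (Cd • W.quadraticTwist (NumberField.discr K : ℚ))
    (W.baseChange K) hGZK hmod hMilne hrW h2 ⟨Cd, rfl⟩ hrd ⟨1, one_smul _ _⟩ hq' hWd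
  haveI : Finite W.sha := (hGZK W hrW).2
  obtain ⟨q₀, hq₀, hv₀⟩ := missingPPartAt_of_bsdp W 2 hW2
  have hqq : q = q₀ := by exact_mod_cast hq.symm.trans hq₀
  subst hqq
  have hsha : padicValNat 2 (Nat.card (AddCommGroup.primaryComponent (W.baseChange K).sha 2)) =
      padicValNat 2 (W.baseChange K).shaOrder :=
    Literature.NumberTheory.EllipticCurves.padicValNat_card_addPrimaryComponent 2
  rw [hsha]
  rw [hv₀, hv] at hdef
  linarith

/-! ### §2 The small-conductor slice of the class (Creutz–Miller bsd.S31, `N_W < 5000`) -/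

/-- **Index EQUALITY on every Heegner frame of a CM curve with `r_an = 1` and `N_W < 5000`.** Named facts taken as hypotheses: the toric prints
and Milne any-model (`hPr`), GZK / modularity / isogeny invariance / Burungale–Flach rank `0` / Kriz–Li (`hB` = 𝔅_split; only GZK, modularity and
Burungale–Flach are used — the twin `E^{(d_K)}` has CM and analytic rank `0`, so `BSD₂` by `Partition.bsdp_cm_rankZero`, as in
`PrintCf2.rankZeroTwistBSDp_two_of_hasCM_of_print`, inlined to stay out of the route cone), and Creutz–Miller 2012 (`hS31`:
`rank ≤ 1 ∧ N < 5000 ⟹ BSDTriple`, hence `BSDp W 2`). In the split-bad class this is the sub-family `N_W ∈ {784, 3136}` (the `t = 3` members of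
the road-β memo). [cite: CreutzMiller2012, Thm 1.1] [cite: Miller2011LMS, Thm 1.2 and Def. 1.1] [cite: BurungaleFlach2024, Thm. 1.1]
[cite: GrossZagier1986, V.(2.2)] -/
theorem heegnerIndexEq_two_of_conductor_lt
    (hPr : ToricPublishedInputs ∧ Milne1972.bsdQuotient_baseChange_quadratic_anyModel)
    (hB : Literature.NumberTheory.EllipticCurves.rank_eq_analyticRank_of_analyticRank_le_one ∧ WeierstrassCurve.hasEntireLFunction_rat ∧
        WeierstrassCurve.bsdRHS_eq_of_isIsogenous ∧ Literature.NumberTheory.EllipticCurves.bsdTriple_of_hasCM_of_L_one_ne_zero ∧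
        Literature.NumberTheory.EllipticCurves.KrizLi2019.thm112_bsdTwo_twist)
    (hS31 : bsdTriple_of_rank_le_one_of_conductor_lt)
    (W : WeierstrassCurve ℚ) [W.IsElliptic] [W.IsGloballyMinimal] (hCM : W.HasCM) (hr : W.analyticRank = 1)
    (hN5 : W.conductorNorm ℤ < 5000) :
    ∀ (N : ℕ) [NeZero N] (K : Type) [Field K] [NumberField K] (Dt : ModularParametrizationData W N)
      (H : HeegnerDatum N (NumberField.discr K)) (ι : K →+* ℂ) (P : (W.baseChange K).toAffine.Point),
      W.conductorNorm ℤ = N → IsImaginaryQuadratic K → SatisfiesHeegnerHypothesis N K → NumberField.discr K < -4 →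
      WeierstrassCurve.Affine.Point.map ι.toRatAlgHom P = heegnerPointComplex Dt H → ¬ IsOfFinAddOrder P →
      (padicValNat 2 (Nat.card (AddCommGroup.primaryComponent (W.baseChange K).sha 2)) : ℤ) +
          (padicValNat 2 (W.baseChange K).tamagawaProduct : ℤ) =
        2 * (padicValNat 2 (AddSubgroup.zmultiples P).index : ℤ) - 2 * (padicValNat 2 Dt.c.natAbs : ℤ) := by
  have hrW : W.analyticRank ≤ 1 := by rw [hr]
  obtain ⟨hrank, -⟩ := hB.1 W hrW
  have hrk : W.mordellWeilRank ≤ 1 := by rw [hrank]; exact hrW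
  have hW2 : BSDp W 2 := forall_bsdp_of_bsdTriple' W (hS31 W hrk hN5) 2 Nat.prime_two
  have hmod : hasEntireLFunction_rat := hB.2.1
  -- the twin's `BSD₂`: `E^{(d_K)}` has CM and analytic rank `0` (Burungale–Flach), on any globally minimal model
  have hTw : ∀ (N : ℕ) [NeZero N] (K : Type) [Field K] [NumberField K]
      (Wd : WeierstrassCurve ℚ) [Wd.IsElliptic] [Wd.IsGloballyMinimal],
      W.conductorNorm ℤ = N → IsImaginaryQuadratic K → SatisfiesHeegnerHypothesis N K →
      (∃ C : VariableChange ℚ, C • W.quadraticTwist (NumberField.discr K : ℚ) = Wd) →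
      (W.quadraticTwist (NumberField.discr K : ℚ)).entireLFunction 1 ≠ 0 → BSDp Wd 2 := by
    intro N _ K _ _ Wd _ _ _ _ _ hC hLt
    obtain ⟨C, rfl⟩ := hC
    have hd : (NumberField.discr K : ℚ) ≠ 0 := by exact_mod_cast NumberField.discr_ne_zero K
    haveI hEd : (W.quadraticTwist (NumberField.discr K : ℚ)).IsElliptic := W.isElliptic_quadraticTwist hd
    have hCMd : (W.quadraticTwist (NumberField.discr K : ℚ)).HasCM := hasCM_quadraticTwist_of_hasCM W hCM hd
    have hCM' : (C • W.quadraticTwist (NumberField.discr K : ℚ)).HasCM :=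
      hasCM_variableChange (W.quadraticTwist (NumberField.discr K : ℚ)) C hCMd
    have hr0d : (W.quadraticTwist (NumberField.discr K : ℚ)).analyticRank = 0 :=
      ((W.quadraticTwist (NumberField.discr K : ℚ)).analyticRank_eq_zero_iff_holds (hmod _)).mpr hLt
    have hr0 : (C • W.quadraticTwist (NumberField.discr K : ℚ)).analyticRank = 0 := by
      rw [WeierstrassCurve.analyticRank_smul]; exact hr0d
    exact bsdp_cm_rankZero hB.2.2.2.1 hmod hCM' hr0
  exact heegnerIndexEq_two_of_bsdp_of_twist hPr.1 (Milne1972.bsdQuotient_baseChange_quadratic_of_anyModel hPr.2) W hr hW2 hTw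

/-- **The text of `stub_heegnerIndexUpperAtTwo` (child 27850, v3 of record 982583d579df569b) RESTRICTED to `N_W < 5000`**, from bsd.S31 — the
displayed frame binders `L(E^{(d_K)},1) ≠ 0`, `r_an(E_K) = 1`, `rank E(K) = 1`, `Ш(E/K)` finite are accepted and not needed. Not the stub (which
is class-wide); the slice where road β's barrier does not bite. [cite: CreutzMiller2012, Thm 1.1] [cite: GrossZagier1986, V.(2.2)] -/
theorem heegnerIndexUpperAtTwo_of_conductor_lt
    (hPr : ToricPublishedInputs ∧ Milne1972.bsdQuotient_baseChange_quadratic_anyModel)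
    (hB : Literature.NumberTheory.EllipticCurves.rank_eq_analyticRank_of_analyticRank_le_one ∧ WeierstrassCurve.hasEntireLFunction_rat ∧
        WeierstrassCurve.bsdRHS_eq_of_isIsogenous ∧ Literature.NumberTheory.EllipticCurves.bsdTriple_of_hasCM_of_L_one_ne_zero ∧
        Literature.NumberTheory.EllipticCurves.KrizLi2019.thm112_bsdTwo_twist)
    (hS31 : bsdTriple_of_rank_le_one_of_conductor_lt) :
    ∀ (W : WeierstrassCurve ℚ) [W.IsElliptic] [W.IsGloballyMinimal], W.HasCM → W.analyticRank = 1 → CMSplit W 2 → ¬ Good W 2 →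
      W.conductorNorm ℤ < 5000 →
      ∀ (N : ℕ) [NeZero N] (K : Type) [Field K] [NumberField K] (Dt : ModularParametrizationData W N)
        (H : HeegnerDatum N (NumberField.discr K)) (ι : K →+* ℂ) (P : (W.baseChange K).toAffine.Point),
        W.conductorNorm ℤ = N → IsImaginaryQuadratic K → SatisfiesHeegnerHypothesis N K → NumberField.discr K < -4 →
        (W.quadraticTwist (NumberField.discr K : ℚ)).entireLFunction 1 ≠ 0 → (W.baseChange K).analyticRank = 1 →
        WeierstrassCurve.Affine.Point.map ι.toRatAlgHom P = heegnerPointComplex Dt H → ¬ IsOfFinAddOrder P →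
        (W.baseChange K).mordellWeilRank = 1 → Finite (W.baseChange K).sha →
        (padicValNat 2 (Nat.card (AddCommGroup.primaryComponent (W.baseChange K).sha 2)) : ℤ) +
            (padicValNat 2 (W.baseChange K).tamagawaProduct : ℤ) ≤
          2 * (padicValNat 2 (AddSubgroup.zmultiples P).index : ℤ) - 2 * (padicValNat 2 Dt.c.natAbs : ℤ) := by
  intro W _ _ hCM hr _ _ hN5 N _ K _ _ Dt H ι P hN hK hHN hd4 _ _ hP hnt _ _
  exact (heegnerIndexEq_two_of_conductor_lt hPr hB hS31 W hCM hr hN5 N K Dt H ι P hN hK hHN hd4 hP hnt).le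

/-- **The text of `stub_heegnerIndexLowerAtTwo` (child 27851, v3 of record f2bd84c029a8a938) RESTRICTED to `N_W < 5000`**, from bsd.S31 (the
equality read in the Eisenstein direction). [cite: CreutzMiller2012, Thm 1.1] [cite: GrossZagier1986, V.(2.2)] -/
theorem heegnerIndexLowerAtTwo_of_conductor_lt
    (hPr : ToricPublishedInputs ∧ Milne1972.bsdQuotient_baseChange_quadratic_anyModel)
    (hB : Literature.NumberTheory.EllipticCurves.rank_eq_analyticRank_of_analyticRank_le_one ∧ WeierstrassCurve.hasEntireLFunction_rat ∧
        WeierstrassCurve.bsdRHS_eq_of_isIsogenous ∧ Literature.NumberTheory.EllipticCurves.bsdTriple_of_hasCM_of_L_one_ne_zero ∧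
        Literature.NumberTheory.EllipticCurves.KrizLi2019.thm112_bsdTwo_twist)
    (hS31 : bsdTriple_of_rank_le_one_of_conductor_lt) :
    ∀ (W : WeierstrassCurve ℚ) [W.IsElliptic] [W.IsGloballyMinimal], W.HasCM → W.analyticRank = 1 → CMSplit W 2 → ¬ Good W 2 →
      W.conductorNorm ℤ < 5000 →
      ∀ (N : ℕ) [NeZero N] (K : Type) [Field K] [NumberField K] (Dt : ModularParametrizationData W N)
        (H : HeegnerDatum N (NumberField.discr K)) (ι : K →+* ℂ) (P : (W.baseChange K).toAffine.Point),
        W.conductorNorm ℤ = N → IsImaginaryQuadratic K → SatisfiesHeegnerHypothesis N K → NumberField.discr K < -4 →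
        (W.quadraticTwist (NumberField.discr K : ℚ)).entireLFunction 1 ≠ 0 → (W.baseChange K).analyticRank = 1 →
        WeierstrassCurve.Affine.Point.map ι.toRatAlgHom P = heegnerPointComplex Dt H → ¬ IsOfFinAddOrder P →
        (W.baseChange K).mordellWeilRank = 1 → Finite (W.baseChange K).sha →
        2 * (padicValNat 2 (AddSubgroup.zmultiples P).index : ℤ) - 2 * (padicValNat 2 Dt.c.natAbs : ℤ) ≤
          (padicValNat 2 (Nat.card (AddCommGroup.primaryComponent (W.baseChange K).sha 2)) : ℤ) +
            (padicValNat 2 (W.baseChange K).tamagawaProduct : ℤ) := by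
  intro W _ _ hCM hr _ _ hN5 N _ K _ _ Dt H ι P hN hK hHN hd4 _ _ hP hnt _ _
  exact (heegnerIndexEq_two_of_conductor_lt hPr hB hS31 W hCM hr hN5 N K Dt H ι P hN hK hHN hd4 hP hnt).ge

end Summit.BirchSwinnertonDyer.BirchSwinnertonDyer.Theorems.PrintCf2.KsideFiniteTwo

end
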